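import Mathlib.FieldTheory.IntermediateField.Adjoin.Defs
import Mathlib.RingTheory.AlgebraicIndependent.Basic
import Mathlib.LinearAlgebra.Quotient.Basic
import Mathlib.LinearAlgebra.Dimension.Finrank
import Mathlib.Algebra.Algebra.Rat
import Literature.ModelTheory.ExponentialFields.ExponentialField
import Literature.NumberTheory.Transcendental.ZilberField
import HarnessLib

/-!
# Kirby's theorems on the exponential-algebraic closure `ecl` (pregeometry, weak Schanuel)

Trunk T-TRANSCEND (`Literature/NumberTheory/Transcendental`), problem `Schanuel`, route
`Schanuel/EclCore`; named facts for `stmt-Schanuel-0067` (part (a)) and `stmt-Schanuel-0068`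
(part (b) with `F = ℂ`, `C = ecl ∅`).

For an exponential field `K` (`[Field K] [CharZero K] [ExponentialRing K]`) with the
exponential-algebraic closure `Literature.ecl A ⊆ K` of `ZilberField.lean` (Kirby 2010, Def. 3.1–3.2:
first coordinates of solutions of Khovanskii systems over `A`), J. Kirby, *Exponential
algebraicity in exponential fields*, Bull. LMS 42 (2010), 879–890 (arXiv:0810.4285) proves:

* **Lemma 3.3.** `ecl` is a closure operator of finite character (`C ⊆ ecl C`, monotone,
  idempotent, `ecl C = ⋃ {ecl C₀ | C₀ ⊆ C finite}`), and `ecl C` is an E-subfield of `K`.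
* **Theorem 1.1.** `ecl` is a pregeometry (i.e. in addition satisfies Steinitz exchange
  `a ∈ ecl(C ∪ {b}) ∖ ecl(C) ⟹ b ∈ ecl(C ∪ {a})`), and agrees with the closure `cl` defined by
  derivations.
* **Theorem 1.2** (weak Schanuel property). If `C ⊆ K` is `ecl`-closed and `x̄ ∈ Kⁿ` then
  `δ(x̄/C) := td(x̄, exp x̄ / C) - ldim_ℚ(x̄/C) ≥ dim(x̄/C)`; in particular `δ(x̄/C) ≥ 0`.
* (§7, proof of Prop. 7.1) `ecl C` is relatively algebraically closed in `K`.

`C ⊆ ecl C` and monotonicity are already proved in `ZilberField.lean` (`subset_ecl`,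
`ecl_mono`). Here we vendor the remaining statements as named facts (`def … : Prop`):
`Kirby2010_ecl_idem`, `Kirby2010_ecl_finiteCharacter`, `Kirby2010_ecl_exchange`,
`Kirby2010_ecl_isExpSubfield`, `Kirby2010_ecl_relAlgClosed` (part (a)) and
`Kirby2010_weakSchanuel` (part (b), the consequence `δ(x̄/C) ≥ 0` of Thm 1.2, which avoids
introducing the dimension function of the pregeometry), together with the definitions of the two
sides of the predimension: `relTrdeg C x = td(x̄, exp x̄ / C)` (nested `IntermediateField.adjoin`,
`Algebra.trdeg`, as in `SchanuelProperty`) and `relLinDim C x = ldim_ℚ(x̄/C)` (rank of the span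
of `x̄` in `K ⧸ ⟨C⟩_ℚ`, via `Submodule.mkQ`), and small proved API.

## Design

* `relTrdeg` is a `Cardinal` (as `Algebra.trdeg` in `Literature.ModelTheory.ExponentialFields.SchanuelProperty`,
  `ExponentialField.lean`), `relLinDim` a natural number (`Module.finrank`, the span is finitely
  generated), cast to `Cardinal` in the inequality; `K` is a `ℚ`-algebra through `algebraRat`
  (`CharZero` field). Part (a) needs no `CharZero`.
* `td(X/Y)` "means the transcendence degree of `ℚ(X, Y)/ℚ(Y)`" (Kirby §1): with
  `L = ℚ(C) = IntermediateField.adjoin ℚ C`, `relTrdeg C x = trdeg_L L(x̄, exp x̄)`.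
* `ldim_ℚ(X/Y)` "means the dimension of the quotient `ℚ`-vector space `⟨X, Y⟩_ℚ / ⟨Y⟩_ℚ`"
  (Kirby §1): `relLinDim C x = rank_ℚ ⟨q(x̄)⟩` for `q : K → K ⧸ ⟨C⟩_ℚ` the quotient map, which is
  the same space (`⟨X, Y⟩/⟨Y⟩ ≅ ⟨q X⟩`).
* "E-subfield" is rendered as: `ecl C` is the carrier of a `Subfield K` and is closed under
  `exp` (no bundled E-subfield type exists in the tree).
* Mathlib has `Algebra.trdeg`, `IntermediateField.adjoin`, `Submodule.mkQ`, `Module.rank`, but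
  no pregeometries/`ecl` (searched `pregeometry`, `Khovanskii`).

## References

* J. Kirby, *Exponential algebraicity in exponential fields*, Bull. Lond. Math. Soc. 42 (2010),
  879–890, arXiv:0810.4285: §1 (Thms 1.1–1.3, conventions for `td`, `ldim_ℚ`), Def. 3.1–3.2,
  Lemma 3.3, §7 (proof of Prop. 7.1: `ecl C` relatively algebraically closed).
* A. Macintyre, *Exponential algebra* (1996) (origin of `ecl`); A. Wilkie (2008), the complex
  case via o-minimality.
-/

noncomputable section

open Set

namespace Literature.NumberTheory.Transcendental

section Closure

variable {K : Type*} [Field K] [Literature.ModelTheory.ExponentialFields.ExponentialRing K]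

/-- A subset `C ⊆ K` is **`ecl`-closed** if `ecl C = C` (equivalently `ecl C ⊆ C`, by
`subset_ecl`). [cite: Kirby2010, Lemma 3.3] -/
def IsEclClosed (C : Set K) : Prop :=
  ecl C = C

/-- `ecl`-closedness from the inclusion `ecl C ⊆ C`. [cite: Kirby2010, Lemma 3.3] -/
theorem isEclClosed_of_subset {C : Set K} (h : ecl C ⊆ C) : IsEclClosed C :=
  Set.Subset.antisymm h (subset_ecl C)

/-! ### Part (a): `ecl` is a pregeometry with E-subfield closures (Lemma 3.3, Thm 1.1) -/

variable (K)

/-- (Kirby 2010, Lemma 3.3, third item.) `ecl` is idempotent: `ecl (ecl C) = ecl C`.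
[cite: Kirby2010, Lemma 3.3] -/
def Kirby2010_ecl_idem : Prop :=
  ∀ C : Set K, ecl (ecl C) = ecl C

/-- (Kirby 2010, Lemma 3.3, fourth item: finite character.)
`ecl C = ⋃ {ecl C₀ | C₀ a finite subset of C}`. [cite: Kirby2010, Lemma 3.3] -/
def Kirby2010_ecl_finiteCharacter : Prop :=
  ∀ C : Set K, ecl C = ⋃ (C₀ : Finset K) (_ : (↑C₀ : Set K) ⊆ C), ecl (↑C₀ : Set K)

/-- (Kirby 2010, Theorem 1.1: "`ecl^F` is a pregeometry", i.e. Lemma 3.3 plus the Steinitz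
exchange property of §1.) Exchange: if `a ∈ ecl(C ∪ {b}) ∖ ecl(C)` then `b ∈ ecl(C ∪ {a})`.
[cite: Kirby2010, Thm. 1.1] -/
def Kirby2010_ecl_exchange : Prop :=
  ∀ (C : Set K) (a b : K), a ∈ ecl (insert b C) → a ∉ ecl C → b ∈ ecl (insert a C)

/-- (Kirby 2010, Lemma 3.3, last sentence: "the closure of any subset is an E-subring of `R`,
and, if `R` is a field, it is an E-subfield".) `ecl C` is the underlying set of a subfield of `K`
which is closed under `exp`. [cite: Kirby2010, Lemma 3.3] -/
def Kirby2010_ecl_isExpSubfield : Prop :=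
  ∀ C : Set K, (∃ S : Subfield K, (S : Set K) = ecl C) ∧
    ∀ a ∈ ecl C, Literature.ModelTheory.ExponentialFields.ExponentialRing.exp a ∈ ecl C

/-- (Kirby 2010, §7, proof of Prop. 7.1: "`ecl^F(C)` [is] relatively algebraically closed in
`F`"; immediate from Lemma 3.3 since a simple root of a one-variable polynomial is a Khovanskii
system with `n = 1`.) Every element of `K` algebraic over `ecl C` — a root of a nonzero
polynomial with coefficients in `ecl C` — lies in `ecl C`.
[cite: Kirby2010, §7 (proof of Prop. 7.1) and Lemma 3.3] -/
def Kirby2010_ecl_relAlgClosed : Prop :=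
  ∀ (C : Set K) (a : K) (p : Polynomial K), p ≠ 0 → (∀ i, p.coeff i ∈ ecl C) → p.IsRoot a →
    a ∈ ecl C

variable {K}

/-- Under idempotence every closure `ecl C` is `ecl`-closed. [cite: Kirby2010, Lemma 3.3] -/
theorem Kirby2010_ecl_idem.isEclClosed_ecl (hidem : Kirby2010_ecl_idem K) (C : Set K) :
    IsEclClosed (ecl C) :=
  hidem C

/-- Under finite character, membership in `ecl C` is witnessed by a finite subset of `C`.
[cite: Kirby2010, Lemma 3.3] -/
theorem Kirby2010_ecl_finiteCharacter.exists_finset (hfc : Kirby2010_ecl_finiteCharacter K)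
    {C : Set K} {a : K} (ha : a ∈ ecl C) :
    ∃ C₀ : Finset K, (↑C₀ : Set K) ⊆ C ∧ a ∈ ecl (↑C₀ : Set K) := by
  rw [hfc C] at ha
  simp only [Set.mem_iUnion] at ha
  obtain ⟨C₀, hC₀, h⟩ := ha
  exact ⟨C₀, hC₀, h⟩

/-- `ecl C` is closed under addition, as a consequence of `Kirby2010_ecl_isExpSubfield`
(unbundling the subfield). [cite: Kirby2010, Lemma 3.3] -/
theorem Kirby2010_ecl_isExpSubfield.add_mem (h : Kirby2010_ecl_isExpSubfield K) {C : Set K}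
    {a b : K} (ha : a ∈ ecl C) (hb : b ∈ ecl C) : a + b ∈ ecl C := by
  obtain ⟨⟨S, hS⟩, -⟩ := h C
  rw [← hS] at ha hb ⊢
  exact S.add_mem ha hb

/-- Closure of `ecl C` under multiplication (from `Kirby2010_ecl_isExpSubfield`).
[cite: Kirby2010, Lemma 3.3] -/
theorem Kirby2010_ecl_isExpSubfield.mul_mem (h : Kirby2010_ecl_isExpSubfield K) {C : Set K}
    {a b : K} (ha : a ∈ ecl C) (hb : b ∈ ecl C) : a * b ∈ ecl C := by
  obtain ⟨⟨S, hS⟩, -⟩ := h C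
  rw [← hS] at ha hb ⊢
  exact S.mul_mem ha hb

/-- Closure of `ecl C` under inversion (from `Kirby2010_ecl_isExpSubfield`).
[cite: Kirby2010, Lemma 3.3] -/
theorem Kirby2010_ecl_isExpSubfield.inv_mem (h : Kirby2010_ecl_isExpSubfield K) {C : Set K}
    {a : K} (ha : a ∈ ecl C) : a⁻¹ ∈ ecl C := by
  obtain ⟨⟨S, hS⟩, -⟩ := h C
  rw [← hS] at ha ⊢
  exact S.inv_mem ha

/-- Closure of `ecl C` under `exp` (from `Kirby2010_ecl_isExpSubfield`).
[cite: Kirby2010, Lemma 3.3] -/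
theorem Kirby2010_ecl_isExpSubfield.exp_mem (h : Kirby2010_ecl_isExpSubfield K) {C : Set K}
    {a : K} (ha : a ∈ ecl C) : Literature.ModelTheory.ExponentialFields.ExponentialRing.exp a ∈ ecl C :=
  (h C).2 a ha

end Closure

/-! ### The two sides of Kirby's predimension `δ(x̄/C) = td(x̄, exp x̄/C) - ldim_ℚ(x̄/C)` -/

section Predimension

variable {K : Type*} [Field K] [CharZero K] [Literature.ModelTheory.ExponentialFields.ExponentialRing K]

/-- `td(x̄, exp x̄ / C)`: the transcendence degree of `ℚ(C)(x̄, exp x̄)` over `ℚ(C)`, with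
`ℚ(C) = IntermediateField.adjoin ℚ C ≤ K` and the outer adjunction taken over `ℚ(C)`
(Kirby 2010, §1: "`td(X/Y)` means the transcendence degree of the field extension
`ℚ(X, Y)/ℚ(Y)`"). A `Cardinal` (finite, at most `2n`), as in `SchanuelProperty`.
[cite: Kirby2010, §1 (conventions after Thm 1.2)] -/
def relTrdeg {n : ℕ} (C : Set K) (x : Fin n → K) : Cardinal :=
  Algebra.trdeg (IntermediateField.adjoin ℚ C)
    ↥(IntermediateField.adjoin (IntermediateField.adjoin ℚ C)
      (Set.range x ∪ Set.range (Literature.ModelTheory.ExponentialFields.ExponentialRing.exp ∘ x)))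

/-- `ldim_ℚ(x̄/C)`: the dimension of the `ℚ`-vector space `⟨x̄, C⟩_ℚ / ⟨C⟩_ℚ`, computed as the
(finite) dimension of the `ℚ`-span of the images of `x₁, …, xₙ` in the quotient `K ⧸ ⟨C⟩_ℚ`
(`Submodule.mkQ`) (Kirby 2010, §1). [cite: Kirby2010, §1 (conventions after Thm 1.2)] -/
def relLinDim {n : ℕ} (C : Set K) (x : Fin n → K) : ℕ :=
  Module.finrank ℚ ↥(Submodule.span ℚ (Set.range ((Submodule.span ℚ C).mkQ ∘ x)))

omit [Literature.ModelTheory.ExponentialFields.ExponentialRing K] in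
/-- `ldim_ℚ(x̄/C) ≤ n` (a span of `n` vectors). [folklore] -/
theorem relLinDim_le {n : ℕ} (C : Set K) (x : Fin n → K) : relLinDim C x ≤ n := by
  simpa [relLinDim, Set.finrank] using
    finrank_range_le_card (R := ℚ) ((Submodule.span ℚ C).mkQ ∘ x)

/-! ### Part (b): the weak Schanuel property over `ecl`-closed sets (Thm 1.2) -/

variable (K)

/-- (Kirby 2010, Theorem 1.2, in the form `δ(x̄/C) ≥ 0`: the printed statement is
`δ(x̄/C) := td(x̄, exp(x̄)/C) - ldim_ℚ(x̄/C) ≥ dim^F(x̄/C)` for `C` `ecl^F`-closed, and the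
pregeometry dimension is `≥ 0`.) For every `ecl`-closed `C ⊆ K` and every tuple `x̄ ∈ Kⁿ`,
`ldim_ℚ(x̄/C) ≤ td(x̄, exp x̄ / C)`. For `K = ℂ`, `C = ecl ∅` this is the statement of
`stmt-Schanuel-0068`; with `C = ∅` (not `ecl`-closed!) it would be the full Schanuel property
`SchanuelProperty K`, which is Schanuel's conjecture for `ℂ`. [cite: Kirby2010, Thm. 1.2] -/
def Kirby2010_weakSchanuel : Prop :=
  ∀ (C : Set K), IsEclClosed C → ∀ (n : ℕ) (x : Fin n → K),
    (relLinDim C x : Cardinal) ≤ relTrdeg C x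

variable {K}

/-- Specialisation of the weak Schanuel property to `C = ecl ∅` (which is `ecl`-closed by
idempotence, `Kirby2010_ecl_idem`): the form used on route `Schanuel/EclCore`.
[cite: Kirby2010, Thm. 1.2] -/
theorem Kirby2010_weakSchanuel.ecl_empty (h : Kirby2010_weakSchanuel K)
    (hidem : Kirby2010_ecl_idem K) {n : ℕ} (x : Fin n → K) :
    (relLinDim (ecl (∅ : Set K)) x : Cardinal) ≤ relTrdeg (ecl (∅ : Set K)) x :=
  h _ (hidem ∅) n x

end Predimension

end Literature.NumberTheory.Transcendental
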